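import Literature.GroupTheory.CombinatorialGroupTheory.CyclicAmalgamQuotientSeparation
import Literature.GroupTheory.CombinatorialGroupTheory.AmalgamConjugacyReduction
import Literature.GroupTheory.CombinatorialGroupTheory.FreeGroupCyclicDoubleCosets
import Literature.GroupTheory.CombinatorialGroupTheory.FreeGroupCyclicIndependence
import HarnessLib

/-!
# Hyperbolic pairs in a cyclic amalgam of free groups are conjugacy-separated (Dyer 1980, Thm. 10)

Topic `Literature/GroupTheory/CombinatorialGroupTheory`; theorems only.  Let `P = ∗_ℤ F(α_i)`
(finitely many free factors of finite rank; `φ_i : ℤ → F(α_i)`, `1 ↦ c_i`, injective) with each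
`⟨c_i⟩` MALNORMAL in its factor (`c_i` not a proper power; for the surface amalgam
`F_{2g} *_ℤ F_{2h}`: the tree's `surfaceAmalgam_malnormal`).  J. L. Dyer, *Separating conjugates in
amalgamated free products and HNN extensions*, J. Austral. Math. Soc. (A) 29 (1980): proof of Thm. 7,
Case 3 (pp. 45–46), transplanted to free factors in Thm. 10 (p. 48) — two CYCLICALLY REDUCED elements
`x = u₁ ⋯ u_k`, `y = v₁ ⋯ v_{k'}` (`k, k' ≥ 2`) with `x ≁_P y` have non-conjugate images in a
finite-factor quotient amalgam `P̄ = ∗_{ℤ/L} (F(α_i)/N_i)` (*"there exists a positive integer `n` such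
that firstly for each `i`, `(I : i)` has a solution … if and only if `π_n(I : i)` has a solution …
We claim that `π_n(x) ≁ π_n(y)`"*), and then in a finite quotient (*"The result now follows from
Theorem 1"*).

The word-combinatorial heart is the tree's ABSTRACT transfer theorem
`Amalgam.not_isConj_lift_of_letterConditions` (`AmalgamConjugacyReduction`); this file VERIFIES its
three letter conditions for the synchronised quotient `exists_synced_quotientAmalgam`
(`CyclicAmalgamSyncedQuotient`) built from
(i) `FreeGroup.exists_normal_finiteIndex_forall_zpow_mul_zpow_ne_of_finite` (cyclic double cosets
are profinitely closed — Dyer's Lemma 9: a sliding equation `c_i^m u = v c_i^{m'}` with no solution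
has none modulo `N_i`),
(ii) `FreeGroup.exists_normal_finiteIndex_conj_zpow_mul_zpow_mem` (independence of `c_i` and
`u⁻¹ c_i u` modulo `L₀` — the finite replacement of Dyer's torsion-free nilpotent quotients: solutions
modulo `N_i` are congruent to the genuine one modulo `L₀`),
(iii) `Amalgam.slide_unique` (malnormality: each sliding equation has at most one genuine solution,
so the genuine exponents are bounded by some `B`; take `L₀ = 2B + 1`),
and finishes with `CyclicAmalgam.exists_normal_finiteIndex_not_isConj_of_map_not_isConj`
(`CyclicAmalgamQuotientSeparation`: finite amalgams are free-by-finite, elements of infinite order of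
free-by-finite groups are conjugacy distinguished).  Different lengths `k ≠ k'` need no transfer
theorem: the images are cyclically reduced of lengths `k ≠ k'` (`Amalgam.length_eq_of_isConj`).

* `CyclicAmalgam.exists_synced_map_lprod_not_isConj` — the synchronised finite-factor quotient with
  `Π (ℓπ w) ≁ Π (ℓπ w')`;
* `CyclicAmalgam.exists_normal_finiteIndex_not_isConj_hyperbolic` — **the hyperbolic case**: `x`, `y`
  conjugate to cyclically reduced words of length `≥ 2`, `x ≁ y` ⇒ `x̄ ≁ ȳ` in some finite quotient
  `P ⧸ N`.

## References

* J. L. Dyer, *Separating conjugates in amalgamated free products and HNN extensions*, J. Austral.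
  Math. Soc. Ser. A 29 (1980) 35–51, Thm. 7 Case 3 pp. 45–46, Thm. 10 p. 48, Lemma 9 p. 47. [Dyer1980]
* W. Magnus, A. Karrass, D. Solitar, *Combinatorial Group Theory*, Interscience (1966), §4.2
  Thm. 4.6. [MagnusKarrassSolitar1966]
-/

namespace Literature.GroupTheory.CombinatorialGroupTheory

open Monoid Monoid.PushoutI Function

namespace CyclicAmalgam

variable {ι : Type} {α : ι → Type}

/-- The value in `PushoutI φ` of a letter list. -/
local notation3 "ℓπ[" ψ "] " l:max =>
  List.prod (List.map (fun x => Monoid.PushoutI.of (φ := ψ) (Sigma.fst x) (Sigma.snd x)) l)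

/-! ### The generator `c = 1 ∈ ℤ` and malnormality -/

/-- `(ofAdd 1) ^ n = ofAdd n` in `Multiplicative ℤ`. [folklore] -/
private theorem ofAdd_one_zpow (n : ℤ) :
    (Multiplicative.ofAdd (1 : ℤ)) ^ n = Multiplicative.ofAdd n := by
  rw [← ofAdd_zsmul, smul_eq_mul, mul_one]

/-! ### The synchronised quotient separating two cyclically reduced words -/

/-- **Dyer's Case 3 for free factors** (Thm. 10 via the proof of Thm. 7, pp. 45–48): for cyclically
reduced words `w`, `w'` of length `≥ 2` with non-conjugate values in `P = ∗_ℤ F(α_i)` (`⟨c_i⟩`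
malnormal), there is a synchronised finite-factor quotient `Π : P → P̄ = ∗_{ℤ/L} (F(α_i)/N_i)`
(letterwise; `ℤ/L ↪ F(α_i)/N_i` injective; the letters of `w`, `w'` kept off `⟨c_i⟩ N_i`) with
`Π (ℓπ w) ≁ Π (ℓπ w')`. [cite: Dyer1980, Thm. 7 Case 3 p.45] -/
theorem exists_synced_map_lprod_not_isConj [Finite ι] [Nonempty ι] [∀ i, Finite (α i)]
    (φ : ∀ i, Multiplicative ℤ →* FreeGroup (α i)) (hφ : ∀ i, Injective (φ i))
    (hmal : ∀ i (g : FreeGroup (α i)), g ∉ (φ i).range →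
      ∀ c : Multiplicative ℤ, g * φ i c * g⁻¹ ∈ (φ i).range → c = 1)
    {w w' : List (Σ i, FreeGroup (α i))}
    (hwc : w.IsChain fun a b => a.1 ≠ b.1) (hwr : ∀ z ∈ w, z.2 ∉ (φ z.1).range)
    (hw2 : 2 ≤ w.length) (hwcr : ∀ a ∈ w.getLast?, ∀ b ∈ w.head?, a.1 ≠ b.1)
    (hw'c : w'.IsChain fun a b => a.1 ≠ b.1) (hw'r : ∀ z ∈ w', z.2 ∉ (φ z.1).range)
    (hw'2 : 2 ≤ w'.length) (hw'cr : ∀ a ∈ w'.getLast?, ∀ b ∈ w'.head?, a.1 ≠ b.1)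
    (hxy : ¬ IsConj (ℓπ[φ] w) (ℓπ[φ] w')) :
    ∃ (L : ℕ) (N : ∀ i, Subgroup (FreeGroup (α i))) (_ : ∀ i, (N i).Normal)
      (φq : ∀ i, Multiplicative (ZMod L) →* FreeGroup (α i) ⧸ N i)
      (Pmap : PushoutI φ →* PushoutI φq),
      0 < L ∧ (∀ i, (N i).FiniteIndex) ∧ (∀ i, Injective (φq i)) ∧
      (∀ i (g : FreeGroup (α i)),
        Pmap ((of (φ := φ) i : FreeGroup (α i) →* PushoutI φ) g) =
          (of (φ := φq) i : (FreeGroup (α i) ⧸ N i) →* PushoutI φq) (QuotientGroup.mk g)) ∧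
      (∀ i (n : ℤ), φq i (Multiplicative.ofAdd ((n : ℤ) : ZMod L)) =
        QuotientGroup.mk (φ i (Multiplicative.ofAdd n))) ∧
      (∀ z ∈ w, z.2 ∉ (((φ z.1).range ⊔ N z.1 : Subgroup (FreeGroup (α z.1))) :
        Set (FreeGroup (α z.1)))) ∧
      ¬ IsConj (Pmap (ℓπ[φ] w)) (Pmap (ℓπ[φ] w')) := by
  classical
  -- the generator of the amalgamated `ℤ` and its images `c_i`
  set c : Multiplicative ℤ := Multiplicative.ofAdd 1 with hc_def
  have hcn : ∀ n : ℤ, c ^ n = Multiplicative.ofAdd n := ofAdd_one_zpow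
  have hφc : ∀ (i) (n : ℤ), φ i (c ^ n) = φ i c ^ n := fun i n => map_zpow _ _ _
  -- genuine sliding equations between letters of the same factor are factor equations
  have up_iff : ∀ {i} (a b : FreeGroup (α i)) (m m' : ℤ),
      base φ (c ^ m) * of i a = of i b * base φ (c ^ m') ↔ φ i c ^ m * a = b * φ i c ^ m' := by
    intro i a b m m'
    rw [Amalgam.base_mul_of_eq_of_mul_base_iff hφ, hφc, hφc]
  /- (iii) the bound `B` on the genuine sliding exponents: each letter pair has at most one solution
  (`slide_unique`), and there are finitely many letter pairs -/
  let bnd : (Σ i, FreeGroup (α i)) × (Σ i, FreeGroup (α i)) → ℕ := fun p =>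
    if h : ∃ mm : ℤ × ℤ, base φ (c ^ mm.1) * of p.1.1 p.1.2 = of p.2.1 p.2.2 * base φ (c ^ mm.2)
    then max h.choose.1.natAbs h.choose.2.natAbs else 0
  let B : ℕ := ((w ×ˢ w').map bnd).sum
  have hB : ∀ za ∈ w, ∀ zb ∈ w', ∀ m m' : ℤ,
      base φ (c ^ m) * of za.1 za.2 = of zb.1 zb.2 * base φ (c ^ m') →
        |m| ≤ (B : ℤ) ∧ |m'| ≤ (B : ℤ) := by
    rintro ⟨i, a⟩ hza ⟨j, b⟩ hzb m m' e
    by_cases hij : i = j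
    · subst hij
      have hex : ∃ mm : ℤ × ℤ, base φ (c ^ mm.1) * of i a = of i b * base φ (c ^ mm.2) :=
        ⟨(m, m'), e⟩
      have hbnd : bnd (⟨i, a⟩, ⟨i, b⟩) = max hex.choose.1.natAbs hex.choose.2.natAbs := by
        simp only [bnd, dif_pos hex]
      have e₀ := hex.choose_spec
      -- uniqueness of the solution
      rw [up_iff] at e e₀
      rw [← hφc, ← hφc] at e e₀
      obtain ⟨h1, h2⟩ := Amalgam.slide_unique hφ (hmal i) (hwr _ hza) e e₀
      rw [hcn, hcn] at h1 h2
      have hm : m = hex.choose.1 := Multiplicative.ofAdd.injective h1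
      have hm' : m' = hex.choose.2 := Multiplicative.ofAdd.injective h2
      have hle : bnd (⟨i, a⟩, ⟨i, b⟩) ≤ B :=
        List.single_le_sum (fun _ _ => Nat.zero_le _) _
          (List.mem_map.mpr ⟨_, List.pair_mem_product.mpr ⟨hza, hzb⟩, rfl⟩)
      rw [hbnd] at hle
      constructor
      · rw [Int.abs_eq_natAbs, hm]; exact_mod_cast (le_max_left _ _).trans hle
      · rw [Int.abs_eq_natAbs, hm']; exact_mod_cast (le_max_right _ _).trans hle
    · exact absurd e (Amalgam.base_mul_of_ne_of_mul_base hφ hij (hwr _ hza) (hw'r _ hzb) _ _)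
  set L₀ : ℕ := 2 * B + 1 with hL₀
  have hL₀pos : 0 < L₀ := by omega
  /- the letters of `w`, `w'`, factor by factor -/
  let A : ∀ i, Set (FreeGroup (α i)) := fun i => {g | (⟨i, g⟩ : Σ i, FreeGroup (α i)) ∈ w}
  let A' : ∀ i, Set (FreeGroup (α i)) := fun i => {g | (⟨i, g⟩ : Σ i, FreeGroup (α i)) ∈ w'}
  have hA : ∀ i, (A i).Finite := fun i => (List.finite_toSet w).preimage sigma_mk_injective.injOn
  have hA' : ∀ i, (A' i).Finite := fun i => (List.finite_toSet w').preimage sigma_mk_injective.injOn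
  /- (i) cyclic double cosets are closed: a sliding equation with no solution has none modulo a
  suitable `M` -/
  have hsol : ∀ (i) (a b : FreeGroup (α i)), ∃ M : Subgroup (FreeGroup (α i)), M.Normal ∧
      M.FiniteIndex ∧ ((∀ s t : ℤ, φ i c ^ s * b * φ i c ^ t ≠ a) →
        ∀ s t : ℤ, ∀ ν ∈ M, φ i c ^ s * b * φ i c ^ t * ν ≠ a) := by
    intro i a b
    by_cases hs : ∀ s t : ℤ, φ i c ^ s * b * φ i c ^ t ≠ a
    · have hg : ∀ s t : ℤ, φ i c ^ s * (b * φ i c * b⁻¹) ^ t ≠ a * b⁻¹ := by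
        intro s t e
        apply hs s t
        rw [conj_zpow, ← mul_assoc, ← mul_assoc] at e
        exact mul_right_cancel e
      obtain ⟨M, hMn, hMf, hM⟩ :=
        FreeGroup.exists_normal_finiteIndex_forall_zpow_mul_zpow_ne_of_finite _ _ _ hg
      refine ⟨M, hMn, hMf, fun _ s t ν hν e => hM s t (b * ν * b⁻¹) (hMn.conj_mem ν hν b) ?_⟩
      rw [conj_zpow]
      calc φ i c ^ s * (b * φ i c ^ t * b⁻¹) * (b * ν * b⁻¹)
          = φ i c ^ s * b * φ i c ^ t * ν * b⁻¹ := by group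
        _ = a * b⁻¹ := by rw [e]
    · exact ⟨⊤, inferInstance, inferInstance, fun h => absurd h hs⟩
  choose Msol hMsol_n hMsol_f hMsol using hsol
  /- (ii) independence of `c_i` and `u⁻¹ c_i u` modulo `L₀` -/
  have hind : ∀ (i) (a : FreeGroup (α i)), ∃ M : Subgroup (FreeGroup (α i)), M.Normal ∧
      M.FiniteIndex ∧ (a ∉ (φ i).range →
        ∀ s t : ℤ, a⁻¹ * φ i c ^ s * a * φ i c ^ t ∈ M → (L₀ : ℤ) ∣ s ∧ (L₀ : ℤ) ∣ t) := by
    intro i a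
    by_cases ha : a ∈ (φ i).range
    · exact ⟨⊤, inferInstance, inferInstance, fun h => absurd ha h⟩
    · obtain ⟨M, hMn, hMf, hM⟩ := FreeGroup.exists_normal_finiteIndex_conj_zpow_mul_zpow_mem
        (not_commute_conj_of_not_mem_range φ (hmal i) ha) L₀ hL₀pos
      exact ⟨M, hMn, hMf, fun _ => hM⟩
  choose Mind hMind_n hMind_f hMind using hind
  /- the requirement subgroups `N₀ i` -/
  haveI : ∀ i, Finite ↥(A i ×ˢ A' i) := fun i => ((hA i).prod (hA' i)).to_subtype
  haveI : ∀ i, Finite ↥(A i) := fun i => (hA i).to_subtype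
  let N₀ : ∀ i, Subgroup (FreeGroup (α i)) := fun i =>
    (⨅ p : ↥(A i ×ˢ A' i), Msol i p.1.1 p.1.2) ⊓ (⨅ a : ↥(A i), Mind i a.1)
  haveI hN₀n : ∀ i, (N₀ i).Normal := fun i => by
    haveI := Subgroup.normal_iInf_normal fun p : ↥(A i ×ˢ A' i) => hMsol_n i p.1.1 p.1.2
    haveI := Subgroup.normal_iInf_normal fun a : ↥(A i) => hMind_n i a.1
    exact Subgroup.normal_inf_normal _ _
  haveI hN₀f : ∀ i, (N₀ i).FiniteIndex := fun i => by
    haveI := Subgroup.finiteIndex_iInf fun p : ↥(A i ×ˢ A' i) => hMsol_f i p.1.1 p.1.2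
    haveI := Subgroup.finiteIndex_iInf fun a : ↥(A i) => hMind_f i a.1
    change ((⨅ p : ↥(A i ×ˢ A' i), Msol i p.1.1 p.1.2) ⊓ (⨅ a : ↥(A i), Mind i a.1)).FiniteIndex
    infer_instance
  have hN₀sol : ∀ (i) (a b : FreeGroup (α i)), a ∈ A i → b ∈ A' i → N₀ i ≤ Msol i a b :=
    fun i a b ha hb => inf_le_left.trans (iInf_le _ (⟨(a, b), ha, hb⟩ : ↥(A i ×ˢ A' i)))
  have hN₀ind : ∀ (i) (a : FreeGroup (α i)), a ∈ A i → N₀ i ≤ Mind i a :=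
    fun i a ha => inf_le_right.trans (iInf_le _ (⟨a, ha⟩ : ↥(A i)))
  /- the synchronised quotient -/
  have hAA : ∀ i, (A i ∪ A' i).Finite := fun i => (hA i).union (hA' i)
  have hAc : ∀ i, Disjoint ((φ i).range : Set (FreeGroup (α i))) (A i ∪ A' i) := by
    intro i
    refine Set.disjoint_left.mpr fun g hg hgA => ?_
    rcases hgA with h | h
    · exact hwr ⟨i, g⟩ h hg
    · exact hw'r ⟨i, g⟩ h hg
  obtain ⟨L, N, hNn, φq, Pmap, -, hLpos, hNf, hNle, hφq_inj, -, hNA, hPof, -, hφq⟩ :=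
    exists_synced_quotientAmalgam φ hφ N₀ (fun i => A i ∪ A' i) hAA hAc L₀ hL₀pos
  haveI : NeZero L := ⟨hLpos.ne'⟩
  have hwN : ∀ z ∈ w, z.2 ∉ (((φ z.1).range ⊔ N z.1 : Subgroup (FreeGroup (α z.1))) :
      Set (FreeGroup (α z.1))) :=
    fun z hz hzN => Set.disjoint_left.mp (hNA z.1) hzN (Or.inl (show z.2 ∈ A z.1 from hz))
  have hw'N : ∀ z ∈ w', z.2 ∉ (((φ z.1).range ⊔ N z.1 : Subgroup (FreeGroup (α z.1))) :
      Set (FreeGroup (α z.1))) :=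
    fun z hz hzN => Set.disjoint_left.mp (hNA z.1) hzN (Or.inr (show z.2 ∈ A' z.1 from hz))
  refine ⟨L, N, hNn, φq, Pmap, hLpos, hNf, hφq_inj, hPof, hφq, hwN, ?_⟩
  -- the images are the residue words, cyclically reduced of the same lengths
  have hφqc : ∀ (i) (n : ℤ), φq i ((Int.castAddHom (ZMod L)).toMultiplicative c ^ n) =
      QuotientGroup.mk (φ i c ^ n) := by
    intro i n
    rw [← map_zpow, hcn, ← hφc, hcn]
    exact hφq i n
  have down_iff : ∀ {i} (a b : FreeGroup (α i)) (n n' : ℤ),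
      base φq ((Int.castAddHom (ZMod L)).toMultiplicative c ^ n) *
          of i (QuotientGroup.mk a : FreeGroup (α i) ⧸ N i) =
        of i (QuotientGroup.mk b : FreeGroup (α i) ⧸ N i) *
          base φq ((Int.castAddHom (ZMod L)).toMultiplicative c ^ n') ↔
      (φ i c ^ n * a)⁻¹ * (b * φ i c ^ n') ∈ N i := by
    intro i a b n n'
    rw [Amalgam.base_mul_of_eq_of_mul_base_iff hφq_inj, hφqc, hφqc, ← QuotientGroup.mk_mul,
      ← QuotientGroup.mk_mul, QuotientGroup.eq]
  rw [map_lprod_eq hPof w, map_lprod_eq hPof w']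
  -- residue words: bookkeeping
  have hRc : ∀ {v : List (Σ i, FreeGroup (α i))}, v.IsChain (fun a b => a.1 ≠ b.1) →
      (v.map fun z => (⟨z.1, (QuotientGroup.mk z.2 : FreeGroup (α z.1) ⧸ N z.1)⟩ :
        Σ i, FreeGroup (α i) ⧸ N i)).IsChain (fun a b => a.1 ≠ b.1) :=
    fun hv => (List.isChain_map _).mpr hv
  have hRr : ∀ {v : List (Σ i, FreeGroup (α i))},
      (∀ z ∈ v, z.2 ∉ (((φ z.1).range ⊔ N z.1 : Subgroup (FreeGroup (α z.1))) :
        Set (FreeGroup (α z.1)))) →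
      ∀ z ∈ (v.map fun z => (⟨z.1, (QuotientGroup.mk z.2 : FreeGroup (α z.1) ⧸ N z.1)⟩ :
        Σ i, FreeGroup (α i) ⧸ N i)), z.2 ∉ (φq z.1).range := by
    intro v hv z hz
    obtain ⟨z', hz', rfl⟩ := List.mem_map.mp hz
    exact mk_not_mem_range hφq (hv z' hz')
  have hRcr : ∀ {v : List (Σ i, FreeGroup (α i))}, (∀ a ∈ v.getLast?, ∀ b ∈ v.head?, a.1 ≠ b.1) →
      ∀ a ∈ (v.map fun z => (⟨z.1, (QuotientGroup.mk z.2 : FreeGroup (α z.1) ⧸ N z.1)⟩ :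
        Σ i, FreeGroup (α i) ⧸ N i)).getLast?,
      ∀ b ∈ (v.map fun z => (⟨z.1, (QuotientGroup.mk z.2 : FreeGroup (α z.1) ⧸ N z.1)⟩ :
        Σ i, FreeGroup (α i) ⧸ N i)).head?, a.1 ≠ b.1 := by
    intro v hv a ha b hb
    rw [List.getLast?_map, Option.mem_def, Option.map_eq_some_iff] at ha
    rw [List.head?_map, Option.mem_def, Option.map_eq_some_iff] at hb
    obtain ⟨a', ha', rfl⟩ := ha
    obtain ⟨b', hb', rfl⟩ := hb
    exact hv a' ha' b' hb'
  by_cases hlen : w'.length = w.length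
  · /- same length: the abstract transfer theorem -/
    have key := Amalgam.not_isConj_lift_of_letterConditions (φ := φ) (φ₂ := φq)
      ((Int.castAddHom (ZMod L)).toMultiplicative) (fun i => QuotientGroup.mk' (N i)) hφq_inj c
      ?_ hwc hw2 hwcr hw'c hw'cr hlen ?_ ?_ L₀ B (by omega) ?_ hxy
    · exact key
    · -- `ℤ/L` is generated by the image of `c`
      intro h₂
      obtain ⟨k, hk⟩ := ZMod.intCast_surjective (Multiplicative.toAdd h₂)
      refine ⟨k, ?_⟩
      rw [← map_zpow, hcn]
      change h₂ = Multiplicative.ofAdd ((k : ℤ) : ZMod L)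
      rw [hk]; rfl
    · exact fun z hz => mk_not_mem_range hφq (hwN z hz)
    · exact fun z hz => mk_not_mem_range hφq (hw'N z hz)
    · -- the three letter conditions
      intro r k za zb hza hzb
      have hza' : za ∈ w := List.mem_rotate.mp (List.mem_of_getElem? hza)
      have hzb' : zb ∈ w' := List.mem_of_getElem? hzb
      obtain ⟨i, a⟩ := za
      obtain ⟨j, b⟩ := zb
      have ha : a ∉ (φ i).range := hwr _ hza'
      have hb : b ∉ (φ j).range := hw'r _ hzb'
      have haq : (QuotientGroup.mk a : FreeGroup (α i) ⧸ N i) ∉ (φq i).range :=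
        mk_not_mem_range hφq (hwN _ hza')
      have hbq : (QuotientGroup.mk b : FreeGroup (α j) ⧸ N j) ∉ (φq j).range :=
        mk_not_mem_range hφq (hw'N _ hzb')
      by_cases hij : i = j
      · subst hij
        have hNsol : N i ≤ Msol i a b := (hNle i).trans (hN₀sol i a b hza' hzb')
        have hNind : N i ≤ Mind i a := (hNle i).trans (hN₀ind i a hza')
        refine ⟨?_, ?_, fun m m' e => hB _ hza' _ hzb' m m' e⟩
        · -- (i) no genuine solution ⇒ none modulo `N i`
          intro hno n n' e
          change base φq _ * of i (QuotientGroup.mk a) = of i (QuotientGroup.mk b) * base φq _ at e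
          rw [down_iff] at e
          have hno' : ∀ s t : ℤ, φ i c ^ s * b * φ i c ^ t ≠ a := by
            intro s t hst
            refine hno (-s) t ((up_iff a b (-s) t).mpr ?_)
            rw [← hst, zpow_neg]
            group
          refine hMsol i a b hno' (-n) n' _ (hNsol (inv_mem e)) ?_
          rw [zpow_neg]
          group
        · -- (ii) solutions modulo `N i` are congruent to the genuine one modulo `L₀`
          intro n n' m m' e eu
          change base φq _ * of i (QuotientGroup.mk a) = of i (QuotientGroup.mk b) * base φq _ at e
          rw [down_iff] at e
          rw [up_iff] at eu
          have hbu : b = φ i c ^ m * a * (φ i c ^ m')⁻¹ := by rw [eu, mul_inv_cancel_right]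
          have hmem : a⁻¹ * φ i c ^ (m - n) * a * φ i c ^ (n' - m') ∈ N i := by
            have : a⁻¹ * φ i c ^ (m - n) * a * φ i c ^ (n' - m') =
                (φ i c ^ n * a)⁻¹ * (b * φ i c ^ n') := by
              rw [hbu, zpow_sub, zpow_sub]; group
            rw [this]; exact e
          obtain ⟨h1, h2⟩ := hMind i a ha (m - n) (n' - m') (hNind hmem)
          exact ⟨dvd_sub_comm.mp h1, h2⟩
      · -- letters of different factors: no sliding equation at all
        refine ⟨fun _ n n' => ?_, fun n n' m m' e => ?_, fun m m' e => ?_⟩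
        · exact Amalgam.base_mul_of_ne_of_mul_base hφq_inj hij haq hbq _ _
        · exact absurd e (Amalgam.base_mul_of_ne_of_mul_base hφq_inj hij haq hbq _ _)
        · exact absurd e (Amalgam.base_mul_of_ne_of_mul_base hφ hij ha hb _ _)
  · /- different lengths: cyclically reduced images of different lengths are not conjugate -/
    intro hconj
    apply hlen
    have := Amalgam.length_eq_of_isConj hφq_inj (hRc hwc) (hRr hwN) (by simpa using hw2) (hRcr hwcr)
      (hRc hw'c) (hRr hw'N) (by simpa using hw'2) (hRcr hw'cr) hconj
    simpa using this

/-! ### The hyperbolic case -/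

/-- **Hyperbolic pairs are conjugacy-separated** (Dyer 1980 Thm. 10 / proof of Thm. 7 Case 3 + Thm. 1
for elements of infinite order): in `P = ∗_ℤ F(α_i)` (finitely many free factors of finite rank,
injective `φ_i`, each `⟨c_i⟩` malnormal), if `x` and `y` are conjugate to cyclically reduced words of
length `≥ 2` and `x ≁ y`, then `x̄ ≁ ȳ` in `P ⧸ N` for some normal subgroup `N` of finite index.
[cite: Dyer1980, Thm. 10 p.48] -/
theorem exists_normal_finiteIndex_not_isConj_hyperbolic [Finite ι] [Nonempty ι]
    [∀ i, Finite (α i)] (φ : ∀ i, Multiplicative ℤ →* FreeGroup (α i)) (hφ : ∀ i, Injective (φ i))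
    (hmal : ∀ i (g : FreeGroup (α i)), g ∉ (φ i).range →
      ∀ c : Multiplicative ℤ, g * φ i c * g⁻¹ ∈ (φ i).range → c = 1)
    {x y : PushoutI φ} {w w' : List (Σ i, FreeGroup (α i))}
    (hwc : w.IsChain fun a b => a.1 ≠ b.1) (hwr : ∀ z ∈ w, z.2 ∉ (φ z.1).range)
    (hw2 : 2 ≤ w.length) (hwcr : ∀ a ∈ w.getLast?, ∀ b ∈ w.head?, a.1 ≠ b.1)
    (hw'c : w'.IsChain fun a b => a.1 ≠ b.1) (hw'r : ∀ z ∈ w', z.2 ∉ (φ z.1).range)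
    (hw'2 : 2 ≤ w'.length) (hw'cr : ∀ a ∈ w'.getLast?, ∀ b ∈ w'.head?, a.1 ≠ b.1)
    (hx : ∃ p : PushoutI φ, p * x * p⁻¹ = ℓπ[φ] w) (hy : ∃ p : PushoutI φ, p * y * p⁻¹ = ℓπ[φ] w')
    (hxy : ¬ IsConj x y) :
    ∃ (N : Subgroup (PushoutI φ)) (_ : N.Normal) (_ : N.FiniteIndex),
      ¬ IsConj (QuotientGroup.mk x : PushoutI φ ⧸ N) (QuotientGroup.mk y) := by
  obtain ⟨p, hp⟩ := hx
  obtain ⟨p', hp'⟩ := hy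
  have hx' : IsConj x (ℓπ[φ] w) := isConj_iff.mpr ⟨p, hp⟩
  have hy' : IsConj y (ℓπ[φ] w') := isConj_iff.mpr ⟨p', hp'⟩
  have hww : ¬ IsConj (ℓπ[φ] w) (ℓπ[φ] w') := fun h => hxy ((hx'.trans h).trans hy'.symm)
  obtain ⟨L, N, hNn, φq, Pmap, hLpos, hNf, hφq_inj, hPof, hφq, hwN, hnc⟩ :=
    exists_synced_map_lprod_not_isConj φ hφ hmal hwc hwr hw2 hwcr hw'c hw'r hw'2 hw'cr hww
  haveI : NeZero L := ⟨hLpos.ne'⟩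
  refine exists_normal_finiteIndex_not_isConj_of_map_not_isConj hNf hφq_inj hPof hφq hwc hwN hw2
    hwcr ⟨p, hp⟩ fun h => hnc ?_
  exact ((Pmap.map_isConj hx').symm.trans h).trans (Pmap.map_isConj hy')

end CyclicAmalgam

end Literature.GroupTheory.CombinatorialGroupTheory
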